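import Mathlib.Analysis.Calculus.Deriv.Mul
import Mathlib.Analysis.Normed.Operator.BoundedLinearMaps
import Mathlib.Analysis.ODE.Gronwall
import Mathlib.Algebra.QuadraticDiscriminant
import HarnessLib

/-!
# Decay of 2-volumes in a time-varying metric (Leonov's Lyapunov-transformed Lozinskiĭ estimate, `k = 2`)

Topic `Literature/Dynamics/Contraction`; companion to `AdditiveCompound.lean` / `GramArea.lean`,
delivering the "varying metric" part of definition request `defn-SecondAdditiveCompound` (route
`Summits/NavierStokesRegularity/…/DulacContraction`, support item `RelativeContractionEngine`):
the 2-volume `|x ∧ y|²_Q = Q(x,x) Q(y,y) − Q(x,y)²` of two solutions of `ẋ = A(t) x` measured in a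
time-dependent positive definite quadratic form `Q = Q(t)` (in applications `Q = Q(x(t))` along a
trajectory, Leonov's varying Lyapunov-type metric), and its exponential decay under the trace /
Ky Fan form of the condition `μ_{Q}(A^{[2]} + "½ Q⁻¹ Q̇") ≤ κ`.

**Sources.**
* N. V. Kuznetsov, V. Reitmann, *Attractor Dimension Estimates for Dynamical Systems* (Springer,
  2021), §2.4.1: Definition 2.6 (logarithmic norm), Theorem 2.2 (Lozinskiĭ estimate
  `‖Φ(t)‖ ≤ exp ∫₀ᵗ Λ(A)`), Proposition 2.17 (`Λ₂(A^{[k]}) = λ₁ + ⋯ + λ_k` of `(A + A^*)/2`), and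
  Remark 2.3: under a Lyapunov transformation `ṽ = Q(t) v` the estimate becomes
  `exp ∫ Λ(Q̇ Q⁻¹ + Q A Q⁻¹)` — the varying-metric form; Ch. 5 uses it with `A ↦ Df^{[2]}`.
* M. Y. Li, J. S. Muldowney, SIAM J. Math. Anal. 27 (1996), §2 (`B = A_f A⁻¹ + A J^{[2]} A⁻¹`).
* P. Constantin, C. Foias, *Navier–Stokes Equations* (1988), Ch. 13, Lemma 13.4 (fixed metric).

**Dictionary.**  For a symmetric positive definite matrix `P(t)` and `Q = P^{1/2}`, the quadratic
form is `B_t(u,v) = ⟨P(t) u, v⟩`; orthonormality below is `P`-orthonormality; and for `P`-orthonormal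
`u, v` the quantity `½ Ḃ_t(u,u) + B_t(A u, u) + ½ Ḃ_t(v,v) + B_t(A v, v)` is the compression to
`span{u,v}` of the symmetric part of `Q A Q⁻¹ + Q̇ Q⁻¹`, whose top-two eigenvalue sum is
`Λ₂((Q A Q⁻¹ + Q̇ Q⁻¹)^{[2]}) = Λ₂(Q^{(2)} A^{[2]} (Q^{(2)})⁻¹ + (Q^{(2)})˙ (Q^{(2)})⁻¹)`
(Proposition 2.17 with Remark 2.3).  We work directly with the bilinear forms, on any real normed
space, so no inverse, square root or finite-dimensionality is needed.

**Contents** (namespace `Literature.Dynamics.Contraction`).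
* `metricArea B x y = B x x · B y y − (B x y)²` and the pairing
  `metricPair B C x y = C x x · B y y + B x x · C y y − B x y · (C x y + C y x)` (for `C = B(f·,·)`
  this is `⟨f^{[2]}(x ∧ y), x ∧ y⟩_B`, cf. `GramArea.gramForm_secondAdditiveCompound_wedge`), with
  scaling, shear invariance, Cauchy–Schwarz (`metricArea_nonneg`), the orthonormal evaluation
  `metricPair B C u v = C u u + C v v`, and the Ky Fan direction
  `metricPair_le_of_orthonormal`: `C u u + C v v ≤ κ` on `B`-orthonormal pairs implies
  `metricPair B C x y ≤ κ · metricArea B x y`.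
* `hasDerivWithinAt_metricArea`: the derivative of `τ ↦ |x(τ) ∧ y(τ)|²_{B(τ)}`;
  `metricArea_le_mul_exp`: **if `B(t)` is symmetric positive definite, `C¹` in `t`, `ẋ = A(t) x`,
  `ẏ = A(t) y`, and `½ Ḃ(u,u) + B(A u, u) + ½ Ḃ(v,v) + B(A v, v) ≤ κ` for all `B(t)`-orthonormal
  `u, v`, then `|x(t) ∧ y(t)|²_{B(t)} ≤ |x(0) ∧ y(0)|²_{B(0)} e^{2κt}`**, and the square-root form
  `sqrt_metricArea_le_mul_exp`.

For `B = ⟪·,·⟫` constant, `metricArea B = gramArea` and `metricPair B ⟪f·,·⟫ x y =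
⟨f^{[2]}(x ∧ y), x ∧ y⟩` of `GramArea.lean` (by `gramForm_secondAdditiveCompound_wedge`; the formal
link lemmas are left to that file to keep this one on Mathlib-only imports).

## Mathlib search

`HasDerivWithinAt.clm_apply`, `ContinuousOn.clm_apply`, `UniqueDiffWithinAt.eq_deriv`,
`uniqueDiffWithinAt_Ici`, `discrim_le_zero`-style Cauchy–Schwarz (done by hand),
`le_gronwallBound_of_liminf_deriv_right_le`, `gronwallBound_ε0`.  Nothing on time-varying metrics /
Lyapunov transformations in Mathlib or Literature.  No named fact is introduced; all proved.

## References

* N. V. Kuznetsov, V. Reitmann, *Attractor Dimension Estimates for Dynamical Systems: Theory and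
  Computation*, Springer (2021), §2.4.1 (Def. 2.6, Thm. 2.2, Prop. 2.17, Remark 2.3).
  [KuznetsovReitmann2021]
* M. Y. Li, J. S. Muldowney, *A geometric approach to global-stability problems*, SIAM J. Math.
  Anal. 27 (1996) 1070–1083, §2. [LiMuldowney1996]
* P. Constantin, C. Foias, *Navier–Stokes Equations*, Univ. Chicago Press (1988), Ch. 13,
  Lemma 13.4. [ConstantinFoias1988]
-/

noncomputable section

open scoped Topology
open Set Filter

namespace Literature.Dynamics.Contraction

variable {E : Type*} [NormedAddCommGroup E] [NormedSpace ℝ E]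

/-! ### 2-volumes and the compound pairing in the metric of a bilinear form -/

section Algebra

/-- **`|x ∧ y|²_B = B(x,x) B(y,y) − B(x,y)²`**, the squared 2-volume of the parallelogram on `x, y`
in the metric of the (symmetric, positive) bilinear form `B` — the Gram determinant of `x, y`
for `B`. [cite: KuznetsovReitmann2021, §2.4.1 Remark 2.3] -/
def metricArea (B : E →L[ℝ] E →L[ℝ] ℝ) (x y : E) : ℝ := B x x * B y y - B x y ^ 2

/-- **The compound pairing** `metricPair B C x y = C(x,x) B(y,y) + B(x,x) C(y,y) − B(x,y)(C(x,y) + C(y,x))`: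
for `C = B(f ·, ·)` it is `⟨f^{[2]}(x ∧ y), x ∧ y⟩_B = ⟨f x ∧ y + x ∧ f y, x ∧ y⟩_B`; in general it
is half the `t`-derivative of `|x ∧ y|²_B` when `d/dt B(u,v) = C(u,v) + C(v,u)` along the motion.
[cite: KuznetsovReitmann2021, §2.4.1 Remark 2.3] -/
def metricPair (B C : E →L[ℝ] E →L[ℝ] ℝ) (x y : E) : ℝ :=
  C x x * B y y + B x x * C y y - B x y * (C x y + C y x)

/-- Unfolding lemma for `metricArea`. [folklore] -/
theorem metricArea_def (B : E →L[ℝ] E →L[ℝ] ℝ) (x y : E) :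
    metricArea B x y = B x x * B y y - B x y ^ 2 := rfl

/-- Unfolding lemma for `metricPair`. [folklore] -/
theorem metricPair_def (B C : E →L[ℝ] E →L[ℝ] ℝ) (x y : E) :
    metricPair B C x y = C x x * B y y + B x x * C y y - B x y * (C x y + C y x) := rfl

/-- `|0 ∧ y|²_B = 0`. [folklore] -/
@[simp] theorem metricArea_zero_left (B : E →L[ℝ] E →L[ℝ] ℝ) (y : E) : metricArea B 0 y = 0 := by
  simp [metricArea]

/-- `|x ∧ 0|²_B = 0`. [folklore] -/
@[simp] theorem metricArea_zero_right (B : E →L[ℝ] E →L[ℝ] ℝ) (x : E) : metricArea B x 0 = 0 := by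
  simp [metricArea]

/-- The pairing vanishes on `0 ∧ y`. [folklore] -/
@[simp] theorem metricPair_zero_left (B C : E →L[ℝ] E →L[ℝ] ℝ) (y : E) :
    metricPair B C 0 y = 0 := by
  simp [metricPair]

/-- The pairing vanishes on `x ∧ 0`. [folklore] -/
@[simp] theorem metricPair_zero_right (B C : E →L[ℝ] E →L[ℝ] ℝ) (x : E) :
    metricPair B C x 0 = 0 := by
  simp [metricPair]

/-- Scaling: `|(a x) ∧ (b y)|²_B = a² b² |x ∧ y|²_B`. [folklore] -/
theorem metricArea_smul_smul (B : E →L[ℝ] E →L[ℝ] ℝ) (a b : ℝ) (x y : E) :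
    metricArea B (a • x) (b • y) = a ^ 2 * b ^ 2 * metricArea B x y := by
  simp only [metricArea, map_smul, smul_apply, smul_eq_mul]
  ring

/-- Scaling of the pairing: both slots of `x ∧ y` scale. [folklore] -/
theorem metricPair_smul_smul (B C : E →L[ℝ] E →L[ℝ] ℝ) (a b : ℝ) (x y : E) :
    metricPair B C (a • x) (b • y) = a ^ 2 * b ^ 2 * metricPair B C x y := by
  simp only [metricPair, map_smul, smul_apply, smul_eq_mul]
  ring

/-- **Shear invariance** `|x ∧ (y + c x)|²_B = |x ∧ y|²_B` for symmetric `B`. [folklore] -/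
theorem metricArea_add_smul (B : E →L[ℝ] E →L[ℝ] ℝ) (hB : ∀ u v, B u v = B v u) (x y : E)
    (c : ℝ) : metricArea B x (y + c • x) = metricArea B x y := by
  simp only [metricArea, map_add, map_smul, add_apply, smul_apply, smul_eq_mul, hB y x]
  ring

/-- Shear invariance of the pairing (for symmetric `B`; no condition on `C`). [folklore] -/
theorem metricPair_add_smul (B C : E →L[ℝ] E →L[ℝ] ℝ) (hB : ∀ u v, B u v = B v u) (x y : E)
    (c : ℝ) : metricPair B C x (y + c • x) = metricPair B C x y := by
  simp only [metricPair, map_add, map_smul, add_apply, smul_apply, smul_eq_mul, hB y x]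
  ring

/-- `B`-orthogonal vectors: `|x ∧ w|²_B = B(x,x) B(w,w)`. [folklore] -/
theorem metricArea_of_orthogonal (B : E →L[ℝ] E →L[ℝ] ℝ) {x w : E} (h : B x w = 0) :
    metricArea B x w = B x x * B w w := by
  rw [metricArea, h]
  ring

/-- **The trace formula on a `B`-orthonormal pair**: `metricPair B C u v = C(u,u) + C(v,v)`.
[cite: KuznetsovReitmann2021, §2.4.1 Proposition 2.17] -/
theorem metricPair_of_orthonormal (B C : E →L[ℝ] E →L[ℝ] ℝ) {u v : E} (hu : B u u = 1)
    (hv : B v v = 1) (huv : B u v = 0) : metricPair B C u v = C u u + C v v := by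
  rw [metricPair, hu, hv, huv]
  ring

/-- **Cauchy–Schwarz for `B`**: a symmetric positive semidefinite form has `0 ≤ |x ∧ y|²_B`.
[folklore] -/
theorem metricArea_nonneg (B : E →L[ℝ] E →L[ℝ] ℝ) (hB : ∀ u v, B u v = B v u)
    (hB0 : ∀ u, 0 ≤ B u u) (x y : E) : 0 ≤ metricArea B x y := by
  -- `0 ≤ B(y,y) t² + 2 B(x,y) t + B(x,x)` for all `t`, so the discriminant is `≤ 0`
  have hquad : ∀ t : ℝ, 0 ≤ B y y * (t * t) + 2 * B x y * t + B x x := by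
    intro t
    have h := hB0 (x + t • y)
    have hexp : B (x + t • y) (x + t • y) = B y y * (t * t) + 2 * B x y * t + B x x := by
      simp only [map_add, map_smul, add_apply, smul_apply, smul_eq_mul, hB y x]
      ring
    rwa [hexp] at h
  have hdisc := discrim_le_zero hquad
  rw [discrim] at hdisc
  rw [metricArea]
  nlinarith [hdisc]

/-- Two-vector Gram–Schmidt for `B`: if `B(x,x) ≠ 0`, every `y` is `w + c x` with `B(x,w) = 0`.
[folklore] -/
theorem exists_eq_add_smul_of_metric (B : E →L[ℝ] E →L[ℝ] ℝ) {x : E} (hx : B x x ≠ 0) (y : E) :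
    ∃ (w : E) (c : ℝ), y = w + c • x ∧ B x w = 0 := by
  refine ⟨y - (B x y / B x x) • x, B x y / B x x, (sub_add_cancel _ _).symm, ?_⟩
  rw [map_sub, map_smul, smul_eq_mul, div_mul_cancel₀ _ hx, sub_self]

/-- **Ky Fan direction in the metric `B`**: if `B` is symmetric positive definite and
`C(u,u) + C(v,v) ≤ κ` for every `B`-orthonormal pair, then
`metricPair B C x y ≤ κ |x ∧ y|²_B` for all `x, y` (Gram–Schmidt in `span{x,y}`; both sides scale by
`det²`). [cite: KuznetsovReitmann2021, §2.4.1 Proposition 2.17] -/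
theorem metricPair_le_of_orthonormal (B C : E →L[ℝ] E →L[ℝ] ℝ) (hB : ∀ u v, B u v = B v u)
    (hBp : ∀ u, u ≠ 0 → 0 < B u u) {κ : ℝ}
    (hC : ∀ u v : E, B u u = 1 → B v v = 1 → B u v = 0 → C u u + C v v ≤ κ) (x y : E) :
    metricPair B C x y ≤ κ * metricArea B x y := by
  by_cases hx : x = 0
  · subst hx
    rw [metricPair_zero_left, metricArea_zero_left, mul_zero]
  have hxp : 0 < B x x := hBp x hx
  obtain ⟨w, c, rfl, hxw⟩ := exists_eq_add_smul_of_metric B hxp.ne' y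
  rw [metricPair_add_smul B C hB, metricArea_add_smul B hB, metricArea_of_orthogonal B hxw]
  by_cases hw : w = 0
  · subst hw
    rw [metricPair_zero_right, map_zero, mul_zero, mul_zero]
  have hwp : 0 < B w w := hBp w hw
  -- the `B`-orthonormal pair `u = x/√B(x,x)`, `v = w/√B(w,w)`
  set a := Real.sqrt (B x x) with ha
  set b := Real.sqrt (B w w) with hb
  have ha0 : 0 < a := Real.sqrt_pos.mpr hxp
  have hb0 : 0 < b := Real.sqrt_pos.mpr hwp
  have ha2 : a ^ 2 = B x x := Real.sq_sqrt hxp.le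
  have hb2 : b ^ 2 = B w w := Real.sq_sqrt hwp.le
  have hu : B (a⁻¹ • x) (a⁻¹ • x) = 1 := by
    simp only [map_smul, smul_apply, smul_eq_mul]
    rw [← ha2]
    field_simp
  have hv : B (b⁻¹ • w) (b⁻¹ • w) = 1 := by
    simp only [map_smul, smul_apply, smul_eq_mul]
    rw [← hb2]
    field_simp
  have huv : B (a⁻¹ • x) (b⁻¹ • w) = 0 := by
    simp only [map_smul, smul_apply, smul_eq_mul, hxw, mul_zero]
  have hQ := hC _ _ hu hv huv
  -- undo the normalisation: `x = a (a⁻¹ x)`, `w = b (b⁻¹ w)`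
  have hdec : metricPair B C x w = a ^ 2 * b ^ 2 * metricPair B C (a⁻¹ • x) (b⁻¹ • w) := by
    rw [← metricPair_smul_smul, smul_smul, smul_smul, mul_inv_cancel₀ ha0.ne',
      mul_inv_cancel₀ hb0.ne', one_smul, one_smul]
  rw [hdec, metricPair_of_orthonormal B C hu hv huv, ← ha2, ← hb2]
  have hs : 0 ≤ a ^ 2 * b ^ 2 := by positivity
  calc a ^ 2 * b ^ 2 * (C (a⁻¹ • x) (a⁻¹ • x) + C (b⁻¹ • w) (b⁻¹ • w))
      ≤ a ^ 2 * b ^ 2 * κ := mul_le_mul_of_nonneg_left hQ hs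
    _ = κ * (a ^ 2 * b ^ 2) := by ring

end Algebra

/-! ### The derivative of `|x ∧ y|²_{B(t)}` and the decay estimate -/

section Decay

/-- **Derivative of the 2-volume in a moving metric**: with `Ḃ = B₁`, `ẋ = x'`, `ẏ = y'`,
`d/dt |x ∧ y|²_B = (B₁(x,x) + B(x',x) + B(x,x')) B(y,y) + B(x,x) (B₁(y,y) + B(y',y) + B(y,y'))
 − 2 B(x,y) (B₁(x,y) + B(x',y) + B(x,y'))`. [folklore] -/
theorem hasDerivWithinAt_metricArea {B : ℝ → E →L[ℝ] E →L[ℝ] ℝ} {B₁ : E →L[ℝ] E →L[ℝ] ℝ}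
    {x y : ℝ → E} {x' y' : E} {s : Set ℝ} {t : ℝ}
    (hB : HasDerivWithinAt B B₁ s t) (hx : HasDerivWithinAt x x' s t)
    (hy : HasDerivWithinAt y y' s t) :
    HasDerivWithinAt (fun τ => metricArea (B τ) (x τ) (y τ))
      ((B₁ (x t) (x t) + B t x' (x t) + B t (x t) x') * B t (y t) (y t)
        + B t (x t) (x t) * (B₁ (y t) (y t) + B t y' (y t) + B t (y t) y')
        - (B t (x t) (y t) * (B₁ (x t) (y t) + B t x' (y t) + B t (x t) y')
          + (B₁ (x t) (y t) + B t x' (y t) + B t (x t) y') * B t (x t) (y t))) s t := by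
  have hxx := (hB.clm_apply hx).clm_apply hx
  have hyy := (hB.clm_apply hy).clm_apply hy
  have hxy := (hB.clm_apply hx).clm_apply hy
  have h := (hxx.mul hyy).sub (hxy.mul hxy)
  have hfun : (fun τ => metricArea (B τ) (x τ) (y τ)) =
      ((fun τ => B τ (x τ) (x τ)) * fun τ => B τ (y τ) (y τ)) -
        (fun τ => B τ (x τ) (y τ)) * fun τ => B τ (x τ) (y τ) := by
    funext τ
    simp only [Pi.sub_apply, Pi.mul_apply, metricArea, sq]
  rw [hfun]
  refine h.congr_deriv ?_
  simp only [add_apply]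
  ring

/-- The derivative `B₁` of a family of symmetric forms is symmetric (uniqueness of right
derivatives). [folklore] -/
theorem deriv_symm_of_symm {B : ℝ → E →L[ℝ] E →L[ℝ] ℝ} {B₁ : E →L[ℝ] E →L[ℝ] ℝ} {t : ℝ}
    (hBs : ∀ τ u v, B τ u v = B τ v u) (hB : HasDerivWithinAt B B₁ (Ici t) t) (u v : E) :
    B₁ u v = B₁ v u := by
  have h1 : HasDerivWithinAt (fun τ => B τ u v) (B₁ u v) (Ici t) t := by
    simpa using (hB.clm_apply (hasDerivWithinAt_const t (Ici t) u)).clm_apply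
      (hasDerivWithinAt_const t (Ici t) v)
  have h2 : HasDerivWithinAt (fun τ => B τ u v) (B₁ v u) (Ici t) t := by
    have h := (hB.clm_apply (hasDerivWithinAt_const t (Ici t) v)).clm_apply
      (hasDerivWithinAt_const t (Ici t) u)
    simp only [map_zero, add_zero] at h
    have hfun : (fun τ => B τ v u) = fun τ => B τ u v := funext fun τ => hBs τ v u
    rwa [hfun] at h
  exact (uniqueDiffWithinAt_Ici t).eq_deriv _ h1 h2

/-- **The compound equation in a moving metric, tested against `x ∧ y`**: for symmetric `B(τ)` with
right derivative `B₁` at `t` and `ẋ = A x`, `ẏ = A y`,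
`d/dt |x ∧ y|²_B = 2 · metricPair B (½ B₁ + B(A ·, ·)) x y`.
[cite: KuznetsovReitmann2021, §2.4.1 Remark 2.3] [cite: ConstantinFoias1988, Ch. 13 Lemma 13.4] -/
theorem hasDerivWithinAt_metricArea_of_ode {B : ℝ → E →L[ℝ] E →L[ℝ] ℝ} {B₁ : E →L[ℝ] E →L[ℝ] ℝ}
    {A : E →L[ℝ] E} {x y : ℝ → E} {t : ℝ} (hBs : ∀ τ u v, B τ u v = B τ v u)
    (hB : HasDerivWithinAt B B₁ (Ici t) t) (hx : HasDerivWithinAt x (A (x t)) (Ici t) t)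
    (hy : HasDerivWithinAt y (A (y t)) (Ici t) t) :
    HasDerivWithinAt (fun τ => metricArea (B τ) (x τ) (y τ))
      (2 * metricPair (B t) ((1 / 2 : ℝ) • B₁ + (B t).comp A) (x t) (y t)) (Ici t) t := by
  refine (hasDerivWithinAt_metricArea hB hx hy).congr_deriv ?_
  simp only [metricPair, add_apply, smul_apply, smul_eq_mul, ContinuousLinearMap.comp_apply]
  rw [deriv_symm_of_symm hBs hB (y t) (x t), hBs t (x t) (A (x t)), hBs t (y t) (A (y t)),
    hBs t (x t) (A (y t))]
  ring

/-- **Exponential bound for 2-volumes in a time-varying metric** (Lozinskiĭ estimate after a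
Lyapunov transformation, `k = 2`, Euclidean-type norm): let `B(t)` be symmetric, positive definite
on `[0,T)`, continuous on `[0,T]` with right derivative `B'(t)`; let `x, y` solve `ẋ = A(t) x`
(right derivatives on `[0,T)`, continuous on `[0,T]`); and suppose the trace condition
`½ B'(u,u) + B(A u, u) + ½ B'(v,v) + B(A v, v) ≤ κ` for all `t ∈ [0,T)` and all
`B(t)`-orthonormal `u, v`.  Then `|x(t) ∧ y(t)|²_{B(t)} ≤ |x(0) ∧ y(0)|²_{B(0)} e^{2κt}` on
`[0, T]`. [cite: KuznetsovReitmann2021, §2.4.1 Theorem 2.2 and Remark 2.3] -/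
theorem metricArea_le_mul_exp {B B' : ℝ → E →L[ℝ] E →L[ℝ] ℝ} {A : ℝ → E →L[ℝ] E}
    {x y : ℝ → E} {κ T : ℝ}
    (hBs : ∀ τ u v, B τ u v = B τ v u) (hBp : ∀ τ ∈ Ico 0 T, ∀ u : E, u ≠ 0 → 0 < B τ u u)
    (hBc : ContinuousOn B (Icc 0 T)) (hBd : ∀ t ∈ Ico 0 T, HasDerivWithinAt B (B' t) (Ici t) t)
    (hxc : ContinuousOn x (Icc 0 T)) (hyc : ContinuousOn y (Icc 0 T))
    (hx : ∀ t ∈ Ico 0 T, HasDerivWithinAt x (A t (x t)) (Ici t) t)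
    (hy : ∀ t ∈ Ico 0 T, HasDerivWithinAt y (A t (y t)) (Ici t) t)
    (hκ : ∀ t ∈ Ico 0 T, ∀ u v : E, B t u u = 1 → B t v v = 1 → B t u v = 0 →
      B' t u u / 2 + B t (A t u) u + (B' t v v / 2 + B t (A t v) v) ≤ κ) :
    ∀ t ∈ Icc 0 T,
      metricArea (B t) (x t) (y t) ≤ metricArea (B 0) (x 0) (y 0) * Real.exp (2 * κ * t) := by
  have hcont : ContinuousOn (fun τ => metricArea (B τ) (x τ) (y τ)) (Icc 0 T) := by
    unfold metricArea
    exact (((hBc.clm_apply hxc).clm_apply hxc).mul ((hBc.clm_apply hyc).clm_apply hyc)).sub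
      (((hBc.clm_apply hxc).clm_apply hyc).pow 2)
  have key := le_gronwallBound_of_liminf_deriv_right_le
    (f := fun τ => metricArea (B τ) (x τ) (y τ))
    (f' := fun τ => 2 * metricPair (B τ) ((1 / 2 : ℝ) • B' τ + (B τ).comp (A τ)) (x τ) (y τ))
    (δ := metricArea (B 0) (x 0) (y 0)) (K := 2 * κ) (ε := 0) (a := 0) (b := T) hcont ?_ le_rfl ?_
  · intro t ht
    have h := key t ht
    rwa [gronwallBound_ε0, sub_zero] at h
  · intro t ht r hr
    exact (hasDerivWithinAt_metricArea_of_ode hBs (hBd t ht) (hx t ht) (hy t ht)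
      ).liminf_right_slope_le hr
  · intro t ht
    have hC : ∀ u v : E, B t u u = 1 → B t v v = 1 → B t u v = 0 →
        ((1 / 2 : ℝ) • B' t + (B t).comp (A t)) u u +
          ((1 / 2 : ℝ) • B' t + (B t).comp (A t)) v v ≤ κ := by
      intro u v hu hv huv
      have h := hκ t ht u v hu hv huv
      simp only [add_apply, smul_apply, smul_eq_mul, ContinuousLinearMap.comp_apply]
      linarith
    have h := metricPair_le_of_orthonormal (B t) _ (hBs t) (hBp t ht) hC (x t) (y t)
    linarith

/-- **`|x(t) ∧ y(t)|_{B(t)} ≤ e^{κt} |x(0) ∧ y(0)|_{B(0)}`**, the square-root form of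
`metricArea_le_mul_exp` (2-contraction in the varying metric when `κ < 0`).
[cite: KuznetsovReitmann2021, §2.4.1 Theorem 2.2 and Remark 2.3] -/
theorem sqrt_metricArea_le_mul_exp {B B' : ℝ → E →L[ℝ] E →L[ℝ] ℝ} {A : ℝ → E →L[ℝ] E}
    {x y : ℝ → E} {κ T : ℝ}
    (hBs : ∀ τ u v, B τ u v = B τ v u) (hBp : ∀ τ ∈ Ico 0 T, ∀ u : E, u ≠ 0 → 0 < B τ u u)
    (hBc : ContinuousOn B (Icc 0 T)) (hBd : ∀ t ∈ Ico 0 T, HasDerivWithinAt B (B' t) (Ici t) t)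
    (hxc : ContinuousOn x (Icc 0 T)) (hyc : ContinuousOn y (Icc 0 T))
    (hx : ∀ t ∈ Ico 0 T, HasDerivWithinAt x (A t (x t)) (Ici t) t)
    (hy : ∀ t ∈ Ico 0 T, HasDerivWithinAt y (A t (y t)) (Ici t) t)
    (hκ : ∀ t ∈ Ico 0 T, ∀ u v : E, B t u u = 1 → B t v v = 1 → B t u v = 0 →
      B' t u u / 2 + B t (A t u) u + (B' t v v / 2 + B t (A t v) v) ≤ κ) :
    ∀ t ∈ Icc 0 T, Real.sqrt (metricArea (B t) (x t) (y t)) ≤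
      Real.sqrt (metricArea (B 0) (x 0) (y 0)) * Real.exp (κ * t) := by
  intro t ht
  have h := metricArea_le_mul_exp hBs hBp hBc hBd hxc hyc hx hy hκ t ht
  have hexp : Real.exp (2 * κ * t) = Real.exp (κ * t) ^ 2 := by
    rw [← Real.exp_nat_mul]
    congr 1
    push_cast
    ring
  calc Real.sqrt (metricArea (B t) (x t) (y t))
      ≤ Real.sqrt (metricArea (B 0) (x 0) (y 0) * Real.exp (2 * κ * t)) := Real.sqrt_le_sqrt h
    _ = Real.sqrt (metricArea (B 0) (x 0) (y 0)) * Real.exp (κ * t) := by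
        rw [Real.sqrt_mul' _ (Real.exp_pos _).le, hexp, Real.sqrt_sq (Real.exp_pos _).le]

end Decay

end Literature.Dynamics.Contraction
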